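import Literature.AlgebraicGeometry.HodgeTheory.HypersurfaceComplementCharts
import Literature.AlgebraicGeometry.HodgeTheory.HypersurfaceComplementPoints
import Literature.AlgebraicGeometry.HodgeTheory.HypersurfaceTransversalLine
import Literature.AlgebraicTopology.SingularHomology.PositiveAtlasOrientation
import Literature.Topology.FourManifolds.ComplexProjectiveSpaceOrientationProofs
import Mathlib.Analysis.Calculus.InverseFunctionTheorem.FDeriv
import Mathlib.Analysis.Calculus.ContDiff.Operations
import Mathlib.RingTheory.MvPolynomial.EulerIdentity
import HarnessLib

/-!
# The smooth projective hypersurface `V(F) ⊂ ℂℙⁿ⁺¹` as an oriented topological `2n`-manifold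

Family `hodge`, layer `Literature/AlgebraicGeometry/HodgeTheory`. For a homogeneous form
`F ∈ ℂ[z₀, …, z_{n+1}]` whose gradient vanishes at no non-zero zero of `F` (the Jacobian criterion
of smoothness, `IsNonsingular F`; for the hypersurface of a smooth projective `n`-fold this is the
tree's PROVED `Hartshorne1977_smoothHypersurface_jacobian_holds`), the zero set
`Z_F = {[z] ∈ ℂℙⁿ⁺¹ | F(z) = 0}` in the tree's smooth model `ComplexProjectiveSpace (n + 1)` is a
complex submanifold of dimension `n` (Griffiths–Harris, *Principles*, Ch. 0 §2 "submanifolds" and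
Ch. 1 §3; Voisin I §2.1): by the **holomorphic implicit function theorem** it is, near each point and
in a suitable affine chart, the graph of a holomorphic function of `n` of the `n + 1` affine
coordinates. This file builds that structure and orients it:

* `hasStrictFDerivAt_mvPolynomial_eval` — the polynomial function `z ↦ F(z)` has derivative
  `evalDeriv F z = ∑ⱼ (∂ⱼF)(z) dzⱼ`; `sum_mul_eval_pderiv_eq` — Euler's identity evaluated;
* `isPositiveAtlas_of_differentiable_complex` — general: an atlas on `ℝ²ⁿ = ℂⁿ` whose transition
  maps are `ℂ`-differentiable is positive (`det_ℝ = |det_ℂ|² > 0`; Milnor–Stasheff §13 p. 151);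
* `zeroSet F hF`, `fChart` (the dehomogenised form in the affine chart `i`), `fChartDeriv`
  (`hasStrictFDerivAt_fChart`), `exists_fChartDeriv_single_ne_zero` (at every point of the
  hypersurface some `∂f/∂w_k ≠ 0`, by Euler's identity);
* `ChartData`, `ChartData.graphChartC` / `graphChart` — the **graph charts**
  `[z] ↦ (affine coordinates with slot k removed) ∈ ℂⁿ` (resp. realified, `∈ ℝ²ⁿ`), as
  `OpenPartialHomeomorph`s, built from the inverse function theorem
  (`HasStrictFDerivAt.toOpenPartialHomeomorph`);
* `Model F hF hNS` — the hypersurface as a type (synonym of `↥(zeroSet F hF)` carrying the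
  non-singularity hypothesis), compact Hausdorff, with the charted-space structure of ALL graph
  charts (`instChartedSpace`), a positive atlas (`isPositiveAtlas`), whence the **orientation**
  `orientation F hF hNS g` (`positiveAtlasOrientation`; "every complex manifold has a preferred
  orientation", Milnor–Stasheff §13) with its local classes in every graph chart
  (`orientation_localClass_symm_restrOpen`).

Everything is proved; no named facts. Consumer: the degree computation of a smooth hypersurface and
the upper range of Lefschetz's theorem for hypersurfaces (`Voisin2003_…_holds`).

## References

* [GriffithsHarrisPrinciples1978] P. Griffiths, J. Harris, Principles of Algebraic Geometry,
  Wiley 1978, Ch. 0 §2 (complex manifolds, submanifolds, implicit function theorem), Ch. 1 §3.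
* [VoisinHodgeI2002] C. Voisin, Hodge Theory and Complex Algebraic Geometry I, CUP 2002, §2.1.
* [MilnorStasheff1974] J. Milnor, J. Stasheff, Characteristic Classes, Princeton 1974, §13 p. 151.
-/

noncomputable section

open Set Function Topology Filter
open scoped ContDiff

namespace Literature.AlgebraicGeometry.HodgeTheory

open Literature.Topology.FourManifolds Literature.Topology.FourManifolds.ComplexProjectiveSpace
  Literature.AlgebraicTopology.SingularHomology

/-! ### The derivative of a polynomial function -/

section PolyDeriv

variable {m : ℕ}

/-- The derivative `∑ⱼ (∂ⱼF)(z) dzⱼ` of the polynomial function `z ↦ F(z)` at `z`, as a continuous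
linear form. [folklore] -/
def evalDeriv (F : MvPolynomial (Fin m) ℂ) (z : Fin m → ℂ) : (Fin m → ℂ) →L[ℂ] ℂ :=
  ∑ j, MvPolynomial.eval z (MvPolynomial.pderiv j F) • ContinuousLinearMap.proj j

/-- `evalDeriv F z v = ∑ⱼ (∂ⱼF)(z) vⱼ`. [folklore] -/
theorem evalDeriv_apply (F : MvPolynomial (Fin m) ℂ) (z v : Fin m → ℂ) :
    evalDeriv F z v = ∑ j, MvPolynomial.eval z (MvPolynomial.pderiv j F) * v j := by
  simp [evalDeriv]

/-- **The polynomial function `z ↦ F(z)` is strictly differentiable with derivative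
`∑ⱼ (∂ⱼF)(z) dzⱼ`** (induction on `F`; product rule). [folklore] -/
theorem hasStrictFDerivAt_mvPolynomial_eval (F : MvPolynomial (Fin m) ℂ) (z : Fin m → ℂ) :
    HasStrictFDerivAt (fun z => MvPolynomial.eval z F) (evalDeriv F z) z := by
  classical
  induction F using MvPolynomial.induction_on with
  | C a =>
    have h0 : evalDeriv (MvPolynomial.C a : MvPolynomial (Fin m) ℂ) z = 0 := by
      ext v
      simp [evalDeriv_apply]
    rw [h0]
    simpa using hasStrictFDerivAt_const a z
  | add p q hp hq =>
    have hD : evalDeriv (p + q) z = evalDeriv p z + evalDeriv q z := by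
      ext v
      simp [evalDeriv_apply, Finset.sum_add_distrib, add_mul]
    rw [hD]
    exact (hp.add hq).congr_of_eventuallyEq (Filter.Eventually.of_forall fun w => by simp [map_add])
  | mul_X p j hp =>
    have hX : HasStrictFDerivAt (fun z : Fin m → ℂ => z j)
        (ContinuousLinearMap.proj (R := ℂ) (φ := fun _ : Fin m => ℂ) j) z :=
      hasStrictFDerivAt_apply j z
    have h := hp.mul hX
    have hD : evalDeriv (p * MvPolynomial.X j) z =
        MvPolynomial.eval z p • ContinuousLinearMap.proj j + z j • evalDeriv p z := by
      apply ContinuousLinearMap.ext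
      intro v
      change evalDeriv (p * MvPolynomial.X j) z v = MvPolynomial.eval z p • v j + z j • evalDeriv p z v
      rw [evalDeriv_apply, evalDeriv_apply, smul_eq_mul, smul_eq_mul, Finset.mul_sum]
      simp only [MvPolynomial.pderiv_mul, MvPolynomial.pderiv_X, map_add, map_mul, MvPolynomial.eval_X,
        add_mul, Finset.sum_add_distrib]
      rw [add_comm]
      congr 1
      · rw [Finset.sum_eq_single j (fun i _ hij => by
            rw [Pi.single_eq_of_ne (Ne.symm hij), map_zero, mul_zero, zero_mul])
          (fun h => (h (Finset.mem_univ j)).elim)]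
        simp
      · exact Finset.sum_congr rfl fun i _ => by ring
    rw [hD]
    have hfun : (fun z : Fin m → ℂ => MvPolynomial.eval z (p * MvPolynomial.X j)) =
        fun z => MvPolynomial.eval z p * z j := by
      funext z; simp
    rw [hfun]
    exact h

/-- The polynomial function is differentiable with derivative `evalDeriv`. [folklore] -/
theorem hasFDerivAt_mvPolynomial_eval (F : MvPolynomial (Fin m) ℂ) (z : Fin m → ℂ) :
    HasFDerivAt (fun z => MvPolynomial.eval z F) (evalDeriv F z) z :=
  (hasStrictFDerivAt_mvPolynomial_eval F z).hasFDerivAt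

/-- **Euler's identity, evaluated**: `∑ⱼ zⱼ (∂ⱼF)(z) = d · F(z)` for `F` homogeneous of degree `d`.
[folklore] -/
theorem sum_mul_eval_pderiv_eq {F : MvPolynomial (Fin m) ℂ} {d : ℕ} (hF : F.IsHomogeneous d)
    (z : Fin m → ℂ) :
    ∑ j, z j * MvPolynomial.eval z (MvPolynomial.pderiv j F) = d * MvPolynomial.eval z F := by
  have h := congrArg (MvPolynomial.eval z) hF.sum_X_mul_pderiv
  simpa [map_sum] using h

end PolyDeriv

/-! ### Positive atlases from `ℂ`-differentiable transition maps -/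

section ComplexTransitions

variable {n : ℕ} {M : Type*} [TopologicalSpace M]
  [ChartedSpace (EuclideanSpace ℝ (Fin (2 * n))) M]

/-- **An atlas on `ℝ²ⁿ = ℂⁿ` whose transition maps are `ℂ`-differentiable is positive**
(Milnor–Stasheff §13 p. 151, Huybrechts Cor. 1.2.3: the real Jacobian of a holomorphic map is the
realification of its complex Jacobian, of determinant `|det_ℂ|² ≥ 0`; a transition map has an
invertible Jacobian since the reverse transition inverts it near the point). The transition maps are
read in `ℂⁿ` through the realification `R = realCoordinates n`. [cite: MilnorStasheff1974, §13 p. 151] -/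
theorem isPositiveAtlas_of_differentiable_complex
    (H : ∀ c ∈ atlas (EuclideanSpace ℝ (Fin (2 * n))) M,
      ∀ c' ∈ atlas (EuclideanSpace ℝ (Fin (2 * n))) M, ∀ y ∈ c.source ∩ c'.source,
        DifferentiableAt ℂ
          (fun v : Fin n → ℂ => (realCoordinates n).symm (c (c'.symm (realCoordinates n v))))
          ((realCoordinates n).symm (c' y))) :
    IsPositiveAtlas (2 * n) M := by
  intro c hc c' hc' y hy
  set R := realCoordinates n with hR
  set T : (Fin n → ℂ) → (Fin n → ℂ) := fun v => R.symm (c (c'.symm (R v))) with hT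
  set T' : (Fin n → ℂ) → (Fin n → ℂ) := fun u => R.symm (c' (c.symm (R u))) with hT'
  set v₀ : Fin n → ℂ := R.symm (c' y) with hv₀
  have hTv₀ : T v₀ = R.symm (c y) := by
    simp only [hT, hv₀, ContinuousLinearEquiv.apply_symm_apply, c'.left_inv hy.2]
  have HT : DifferentiableAt ℂ T v₀ := H c hc c' hc' y hy
  have HT' : DifferentiableAt ℂ T' (R.symm (c y)) := H c' hc' c hc y ⟨hy.2, hy.1⟩
  set A := fderiv ℂ T v₀ with hA
  set A' := fderiv ℂ T' (R.symm (c y)) with hA'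
  -- `T' ∘ T = id` near `v₀`
  have hev : (fun v => T' (T v)) =ᶠ[𝓝 v₀] id := by
    have hS : IsOpen (R ⁻¹' (c'.target ∩ c'.symm ⁻¹' c.source)) :=
      (c'.isOpen_inter_preimage_symm c.open_source).preimage R.continuous
    have hv₀S : v₀ ∈ R ⁻¹' (c'.target ∩ c'.symm ⁻¹' c.source) := by
      refine ⟨?_, ?_⟩
      · rw [hv₀, R.apply_symm_apply]; exact c'.map_source hy.2
      · change c'.symm (R v₀) ∈ c.source
        rw [hv₀, R.apply_symm_apply, c'.left_inv hy.2]; exact hy.1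
    filter_upwards [hS.mem_nhds hv₀S] with v hv
    simp only [hT, hT', id, R.apply_symm_apply, c.left_inv hv.2, c'.right_inv hv.1, R.symm_apply_apply]
  -- hence `A' ∘ A = id` and `det A ≠ 0`
  have hcomp : HasFDerivAt (fun v => T' (T v)) (A'.comp A) v₀ := by
    have h2 : HasFDerivAt T' A' (T v₀) := by rw [hTv₀]; exact HT'.hasFDerivAt
    exact h2.comp v₀ HT.hasFDerivAt
  have hid : HasFDerivAt (fun v => T' (T v)) (ContinuousLinearMap.id ℂ _) v₀ :=
    (hasFDerivAt_id v₀).congr_of_eventuallyEq hev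
  have hAA : A'.comp A = ContinuousLinearMap.id ℂ _ := hcomp.unique hid
  have hdetA : LinearMap.det (A : (Fin n → ℂ) →ₗ[ℂ] (Fin n → ℂ)) ≠ 0 := by
    intro h0
    have h1 : LinearMap.det ((A'.comp A : (Fin n → ℂ) →L[ℂ] (Fin n → ℂ)) : (Fin n → ℂ) →ₗ[ℂ] (Fin n → ℂ)) =
        LinearMap.det (A' : (Fin n → ℂ) →ₗ[ℂ] (Fin n → ℂ)) * LinearMap.det (A : (Fin n → ℂ) →ₗ[ℂ] (Fin n → ℂ)) := by
      rw [show ((A'.comp A : (Fin n → ℂ) →L[ℂ] (Fin n → ℂ)) : (Fin n → ℂ) →ₗ[ℂ] (Fin n → ℂ)) =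
        (A' : (Fin n → ℂ) →ₗ[ℂ] (Fin n → ℂ)).comp (A : (Fin n → ℂ) →ₗ[ℂ] (Fin n → ℂ)) from rfl,
        LinearMap.det_comp]
    rw [hAA, h0, mul_zero] at h1
    have h2 : LinearMap.det ((ContinuousLinearMap.id ℂ (Fin n → ℂ) : (Fin n → ℂ) →L[ℂ] (Fin n → ℂ)) :
        (Fin n → ℂ) →ₗ[ℂ] (Fin n → ℂ)) = 1 := LinearMap.det_id
    rw [h2] at h1
    exact one_ne_zero h1
  -- the real transition map is `R ∘ T ∘ R⁻¹`
  have hreal : (fun x => c (c'.symm x)) = fun x => R (T (R.symm x)) := by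
    funext x; simp [hT]
  have hderiv : HasFDerivAt (fun x => c (c'.symm x))
      ((R : (Fin n → ℂ) →L[ℝ] _).comp ((A.restrictScalars ℝ).comp (R.symm : _ →L[ℝ] (Fin n → ℂ))))
      (c' y) := by
    rw [hreal]
    have h1 : HasFDerivAt (fun x => R.symm x) (R.symm : _ →L[ℝ] (Fin n → ℂ)) (c' y) :=
      R.symm.hasFDerivAt
    have h2 : HasFDerivAt T (A.restrictScalars ℝ) (R.symm (c' y)) := HT.hasFDerivAt.restrictScalars ℝ
    have h3 : HasFDerivAt (fun u => R u) (R : (Fin n → ℂ) →L[ℝ] _) (T (R.symm (c' y))) :=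
      R.hasFDerivAt
    exact h3.comp (c' y) (h2.comp (c' y) h1)
  refine ⟨_, hderiv, ?_⟩
  rw [det_conj_continuousLinearEquiv]
  have hrs : ((A.restrictScalars ℝ : (Fin n → ℂ) →L[ℝ] (Fin n → ℂ)) : (Fin n → ℂ) →ₗ[ℝ] (Fin n → ℂ)) =
      (A : (Fin n → ℂ) →ₗ[ℂ] (Fin n → ℂ)).restrictScalars ℝ := rfl
  rw [hrs, det_restrictScalars_eq_normSq]
  exact Complex.normSq_pos.2 hdetA

end ComplexTransitions

/-! ### The zero set of a form and its dehomogenisations -/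

section Hypersurface

variable {n : ℕ} (F : MvPolynomial (Fin (n + 2)) ℂ) {d : ℕ} (hF : F.IsHomogeneous d)

/-- **The projective hypersurface `Z_F = {[z] | F(z) = 0} ⊂ ℂℙⁿ⁺¹`** (the complement of the tree's
`hypersurfaceComplement F hF`). [folklore] -/
def zeroSet : Set (ComplexProjectiveSpace (n + 1)) := {p | ¬ FormNeZero F hF p}

/-- `[v] ∈ Z_F ⟺ F(v) = 0`. [folklore] -/
@[simp] theorem mk_mem_zeroSet_iff (v : {v : Fin (n + 2) → ℂ // v ≠ 0}) :
    mk v ∈ zeroSet F hF ↔ MvPolynomial.eval (v : Fin (n + 2) → ℂ) F = 0 := by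
  simp [zeroSet]

/-- `Z_F` is closed. [folklore] -/
theorem isClosed_zeroSet : IsClosed (zeroSet F hF) :=
  (hypersurfaceComplement F hF).isOpen.isClosed_compl

/-- `Z_F` is compact. [folklore] -/
theorem isCompact_zeroSet : IsCompact (zeroSet F hF) := (isClosed_zeroSet F hF).isCompact

/-- **The dehomogenised form in the affine chart `i`**: `f_i(w) = F(insertNth i 1 w)`. [folklore] -/
def fChart (i : Fin (n + 2)) (w : Fin (n + 1) → ℂ) : ℂ := MvPolynomial.eval (Fin.insertNth i 1 w) F

/-- `f_i` is complex-smooth (a polynomial). [folklore] -/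
theorem contDiff_fChart (i : Fin (n + 2)) {m : WithTop ℕ∞} : ContDiff ℂ m (fChart F i) :=
  HypersurfaceComplement.contDiff_eval_insertNth i F

/-- `w ↦ insertNth i 1 w` is an affine map with linear part `insertNth i 0`. [folklore] -/
theorem insertNth_one_eq (i : Fin (n + 2)) (w : Fin (n + 1) → ℂ) :
    (Fin.insertNth i (1 : ℂ) w : Fin (n + 2) → ℂ) = Pi.single i 1 + HypersurfaceComplement.insLin i w := by
  rw [HypersurfaceComplement.insLin_apply]
  funext j
  rcases Fin.eq_self_or_eq_succAbove i j with rfl | ⟨k, rfl⟩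
  · simp [Fin.insertNth_apply_same]
  · simp [Fin.insertNth_apply_succAbove, Fin.succAbove_ne]

/-- Hence it is strictly differentiable with derivative `insertNth i 0`. [folklore] -/
theorem hasStrictFDerivAt_insertNth_one (i : Fin (n + 2)) (w : Fin (n + 1) → ℂ) :
    HasStrictFDerivAt (fun w : Fin (n + 1) → ℂ => (Fin.insertNth i (1 : ℂ) w : Fin (n + 2) → ℂ))
      (HypersurfaceComplement.insLin i) w := by
  have h : (fun w : Fin (n + 1) → ℂ => (Fin.insertNth i (1 : ℂ) w : Fin (n + 2) → ℂ)) =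
      fun w => Pi.single i 1 + HypersurfaceComplement.insLin i w := funext (insertNth_one_eq i)
  rw [h]
  exact ((HypersurfaceComplement.insLin (N := n + 1) i).hasStrictFDerivAt).const_add _

/-- The derivative of `f_i` at `w`. [folklore] -/
def fChartDeriv (i : Fin (n + 2)) (w : Fin (n + 1) → ℂ) : (Fin (n + 1) → ℂ) →L[ℂ] ℂ :=
  (evalDeriv F (Fin.insertNth i 1 w)).comp (HypersurfaceComplement.insLin i)

/-- **`f_i` is strictly differentiable with derivative `fChartDeriv`** (chain rule). [folklore] -/
theorem hasStrictFDerivAt_fChart (i : Fin (n + 2)) (w : Fin (n + 1) → ℂ) :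
    HasStrictFDerivAt (fChart F i) (fChartDeriv F i w) w :=
  (hasStrictFDerivAt_mvPolynomial_eval F _).comp w (hasStrictFDerivAt_insertNth_one i w)

/-- `insertNth i 0 e_k = e_{i.succAbove k}`. [folklore] -/
theorem insertNth_zero_single (i : Fin (n + 2)) (k : Fin (n + 1)) :
    (Fin.insertNth i (0 : ℂ) (Pi.single k 1) : Fin (n + 2) → ℂ) = Pi.single (i.succAbove k) 1 := by
  funext j
  rcases Fin.eq_self_or_eq_succAbove i j with rfl | ⟨l, rfl⟩
  · simp [Fin.insertNth_apply_same]
  · simp [Fin.insertNth_apply_succAbove, Pi.single_apply]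

/-- **The partial derivatives of `f_i`**: `∂f_i/∂w_k (w) = (∂_{i.succAbove k} F)(insertNth i 1 w)`.
[folklore] -/
theorem fChartDeriv_single (i : Fin (n + 2)) (w : Fin (n + 1) → ℂ) (k : Fin (n + 1)) :
    fChartDeriv F i w (Pi.single k 1) =
      MvPolynomial.eval (Fin.insertNth i 1 w) (MvPolynomial.pderiv (i.succAbove k) F) := by
  rw [fChartDeriv, ContinuousLinearMap.comp_apply, HypersurfaceComplement.insLin_apply,
    insertNth_zero_single, evalDeriv_apply,
    Finset.sum_eq_single (i.succAbove k) (fun j _ hj => by simp [hj])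
      (fun h => (h (Finset.mem_univ _)).elim)]
  simp

/-- `w ↦ ∂f_i/∂w_k (w)` is continuous (a polynomial). [folklore] -/
theorem continuous_fChartDeriv_single (i : Fin (n + 2)) (k : Fin (n + 1)) :
    Continuous fun w => fChartDeriv F i w (Pi.single k 1) := by
  simp only [fChartDeriv_single]
  exact (HypersurfaceComplement.contDiff_eval_insertNth i _ (n := 0)).continuous

variable {F}

/-- **Non-singularity** of the form `F` (the Jacobian criterion): the gradient of `F` vanishes at no
non-zero zero of `F`. A predicate on forms, not a named fact; for the hypersurface of a smooth
projective variety it is the tree's `Hartshorne1977_smoothHypersurface_jacobian_holds`.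
[cite: GriffithsHarrisPrinciples1978, Ch. 1 §3] -/
def IsNonsingular (G : MvPolynomial (Fin (n + 2)) ℂ) : Prop :=
  ∀ z : Fin (n + 2) → ℂ, z ≠ 0 → MvPolynomial.eval z G = 0 →
    ∃ j, MvPolynomial.eval z (MvPolynomial.pderiv j G) ≠ 0

include hF in
/-- **At a zero of `f_i` some partial derivative `∂f_i/∂w_k` is non-zero** (for `F` non-singular):
otherwise, by Euler's identity `∑ zⱼ ∂ⱼF = d·F = 0` at `z = insertNth i 1 w` (where `z_i = 1`),
also `∂ᵢF(z) = 0`, contradicting non-singularity. [cite: GriffithsHarrisPrinciples1978, Ch. 1 §3] -/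
theorem exists_fChartDeriv_single_ne_zero (hNS : IsNonsingular F) (i : Fin (n + 2))
    (w : Fin (n + 1) → ℂ) (hw : fChart F i w = 0) :
    ∃ k, fChartDeriv F i w (Pi.single k 1) ≠ 0 := by
  set z : Fin (n + 2) → ℂ := Fin.insertNth i 1 w with hz
  have hzi : z i = 1 := by simp [hz]
  have hz0 : z ≠ 0 := fun h => by simpa [hzi] using congr_fun h i
  obtain ⟨j, hj⟩ := hNS z hz0 hw
  by_contra hcon
  push Not at hcon
  have hk : ∀ k, MvPolynomial.eval z (MvPolynomial.pderiv (i.succAbove k) F) = 0 := fun k => by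
    rw [← fChartDeriv_single]; exact hcon k
  have hi : MvPolynomial.eval z (MvPolynomial.pderiv i F) = 0 := by
    have he := sum_mul_eval_pderiv_eq hF z
    rw [show MvPolynomial.eval z F = 0 from hw, mul_zero, Fin.sum_univ_succAbove _ i] at he
    simpa [hk, hzi] using he
  rcases Fin.eq_self_or_eq_succAbove i j with rfl | ⟨k, rfl⟩
  · exact hj hi
  · exact hj (hk k)

variable (F)

/-! ### Affine coordinates of points of the hypersurface -/

/-- The complex affine coordinates are continuous on the chart domain. [folklore] -/
theorem continuousOn_affineCoordComplex (i : Fin (n + 2)) :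
    ContinuousOn (affineCoordComplex i) {p : ComplexProjectiveSpace (n + 1) | CoordNeZero i p} := by
  have h := (affineChart (n := n + 1) i).continuousOn
  have heq : affineCoordComplex (n := n + 1) i = (realCoordinates (n + 1)).symm ∘ affineChart i := by
    funext p
    simp [affineChart_apply, affineCoord]
  rw [heq]
  exact (realCoordinates (n + 1)).symm.continuous.comp_continuousOn h

/-- `[homogenize i (affine coordinates of q)] = q` on the chart domain. [folklore] -/
theorem mk_homogenize_affineCoordComplex {i : Fin (n + 2)} {q : ComplexProjectiveSpace (n + 1)}
    (hq : CoordNeZero i q) : mk (homogenize i (affineCoordComplex i q)) = q := by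
  have h := (affineChart i).left_inv (show q ∈ (affineChart i).source from hq)
  rw [affineChart_symm_apply, affineChart_apply] at h
  simpa [affineCoord] using h

/-- The affine coordinates of `[homogenize i w]` are `w`. [folklore] -/
theorem affineCoordComplex_mk_homogenize (i : Fin (n + 2)) (w : Fin (n + 1) → ℂ) :
    affineCoordComplex i (mk (homogenize i w)) = w := by
  rw [affineCoordComplex_mk]
  funext j
  simp [homogenize]

/-- **On the hypersurface the dehomogenised form vanishes at the affine coordinates**:
`F([v]) = 0`, `v_i ≠ 0` ⇒ `f_i(affine coordinates of [v]) = v_i^{-d} F(v) = 0`. [folklore] -/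
theorem fChart_affineCoordComplex {q : ComplexProjectiveSpace (n + 1)} (hq : q ∈ zeroSet F hF)
    {i : Fin (n + 2)} (hi : CoordNeZero i q) : fChart F i (affineCoordComplex i q) = 0 := by
  induction q using ind with
  | h v =>
    have hvi : (v : Fin (n + 2) → ℂ) i ≠ 0 := hi
    have hins : (Fin.insertNth i (1 : ℂ) (affineCoordComplex i (mk v)) : Fin (n + 2) → ℂ) =
        ((v : Fin (n + 2) → ℂ) i)⁻¹ • (v : Fin (n + 2) → ℂ) := by
      rw [affineCoordComplex_mk, Fin.insertNth_eq_iff]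
      refine ⟨?_, ?_⟩
      · simp [hvi]
      · funext j
        simp [Fin.removeNth, div_eq_inv_mul]
    rw [fChart, hins, hF.eval_smul_eq, (mk_mem_zeroSet_iff F hF v).1 hq, mul_zero]

/-! ### Graph charts -/

variable {F hF}

/-- **Graph chart data**: a point `p` of the hypersurface, an affine chart `i` containing it and a
slot `k` with `∂f_i/∂w_k ≠ 0` at (the affine coordinates of) `p` — so that near `p` the hypersurface
is the graph of `w_k` as a holomorphic function of the other affine coordinates
(Griffiths–Harris, Ch. 0 §2, implicit function theorem). [cite: GriffithsHarrisPrinciples1978, Ch. 0 §2] -/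
structure ChartData (F : MvPolynomial (Fin (n + 2)) ℂ) {d : ℕ} (hF : F.IsHomogeneous d) where
  /-- the base point -/
  p : ↥(zeroSet F hF)
  /-- the affine chart -/
  i : Fin (n + 2)
  /-- the dependent coordinate -/
  k : Fin (n + 1)
  hi : CoordNeZero i p.1
  hk : fChartDeriv F i (affineCoordComplex i p.1) (Pi.single k 1) ≠ 0

namespace ChartData

variable (D : ChartData F hF)

/-- **The inverse-function-theorem map** `Φ(w) = w + (f_i(w) − w_k) e_k` (replace the coordinate
`w_k` by `f_i(w)`). [cite: GriffithsHarrisPrinciples1978, Ch. 0 §2] -/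
def phi (w : Fin (n + 1) → ℂ) : Fin (n + 1) → ℂ := w + (fChart F D.i w - w D.k) • Pi.single D.k 1

/-- `Φ` is complex-smooth. [folklore] -/
theorem contDiff_phi {m : WithTop ℕ∞} : ContDiff ℂ m D.phi :=
  contDiff_id.add (((contDiff_fChart F D.i).sub (contDiff_apply ℂ ℂ D.k)).smul contDiff_const)

/-- The `k`-th coordinate of `Φ(w)` is `f_i(w)`. [folklore] -/
theorem phi_apply_k (w : Fin (n + 1) → ℂ) : D.phi w D.k = fChart F D.i w := by
  simp [phi]

/-- Removing the slot `k` of `Φ(w)` gives `w` with slot `k` removed. [folklore] -/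
theorem removeNth_phi (w : Fin (n + 1) → ℂ) : Fin.removeNth D.k (D.phi w) = Fin.removeNth D.k w := by
  funext j
  simp [phi, Fin.removeNth, Fin.succAbove_ne]

/-- On the zeros of `f_i`, `Φ(w)` is `w` with slot `k` set to `0`. [folklore] -/
theorem phi_eq_of_fChart_eq_zero {w : Fin (n + 1) → ℂ} (hw : fChart F D.i w = 0) :
    D.phi w = Fin.insertNth D.k 0 (Fin.removeNth D.k w) := by
  rw [Fin.insertNth_removeNth]
  funext j
  by_cases hj : j = D.k
  · subst hj; simp [phi, hw]
  · simp [phi, hw, hj]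

/-- The linear form `ℓ = f_i'(w) − dw_k` of the shear `Φ'(w)`. [folklore] -/
def ell (w : Fin (n + 1) → ℂ) : (Fin (n + 1) → ℂ) →ₗ[ℂ] ℂ :=
  (fChartDeriv F D.i w : (Fin (n + 1) → ℂ) →ₗ[ℂ] ℂ) - LinearMap.proj D.k

/-- `ℓ(v) = f_i'(w) v − v_k`. [folklore] -/
@[simp] theorem ell_apply (w v : Fin (n + 1) → ℂ) : D.ell w v = fChartDeriv F D.i w v - v D.k := rfl

/-- The condition `1 + ℓ(e_k) ≠ 0` of the shear `Φ'(w)`. [folklore] -/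
theorem one_add_ne_zero {w : Fin (n + 1) → ℂ} (hw : fChartDeriv F D.i w (Pi.single D.k 1) ≠ 0) :
    (1 : ℂ) + D.ell w (Pi.single D.k 1) ≠ 0 := by
  simpa using hw

/-- **The derivative of `Φ` at `w`** (where `∂f_i/∂w_k ≠ 0`): the invertible shear
`v ↦ v + (f_i'(w) v − v_k) e_k`. [cite: GriffithsHarrisPrinciples1978, Ch. 0 §2] -/
def phiDerivEquiv (w : Fin (n + 1) → ℂ) (hw : fChartDeriv F D.i w (Pi.single D.k 1) ≠ 0) :
    (Fin (n + 1) → ℂ) ≃L[ℂ] (Fin (n + 1) → ℂ) :=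
  (TransversalLine.shearEquiv (D.ell w) (Pi.single D.k 1) (D.one_add_ne_zero hw)).toContinuousLinearEquiv

/-- Unfolding `phiDerivEquiv`. [folklore] -/
theorem phiDerivEquiv_apply (w : Fin (n + 1) → ℂ) (hw : fChartDeriv F D.i w (Pi.single D.k 1) ≠ 0)
    (v : Fin (n + 1) → ℂ) :
    D.phiDerivEquiv w hw v = v + (fChartDeriv F D.i w v - v D.k) • Pi.single D.k 1 := by
  simp [phiDerivEquiv, TransversalLine.shearEquiv_apply]

/-- **`Φ` is strictly differentiable with derivative the shear `phiDerivEquiv`.** [folklore] -/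
theorem hasStrictFDerivAt_phi (w : Fin (n + 1) → ℂ) (hw : fChartDeriv F D.i w (Pi.single D.k 1) ≠ 0) :
    HasStrictFDerivAt D.phi (D.phiDerivEquiv w hw : (Fin (n + 1) → ℂ) →L[ℂ] (Fin (n + 1) → ℂ)) w := by
  have h1 : HasStrictFDerivAt (fun w => fChart F D.i w - w D.k)
      (fChartDeriv F D.i w - ContinuousLinearMap.proj D.k) w :=
    (hasStrictFDerivAt_fChart F D.i w).sub (hasStrictFDerivAt_apply D.k w)
  have h2 := (hasStrictFDerivAt_id w).add (h1.smul_const (Pi.single D.k (1 : ℂ)))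
  have heq : (D.phiDerivEquiv w hw : (Fin (n + 1) → ℂ) →L[ℂ] (Fin (n + 1) → ℂ)) =
      ContinuousLinearMap.id ℂ _ +
        (fChartDeriv F D.i w - ContinuousLinearMap.proj D.k).smulRight (Pi.single D.k (1 : ℂ)) := by
    ext v j
    simp [phiDerivEquiv_apply]
  rw [heq]
  exact h2

/-- The open set where `∂f_i/∂w_k ≠ 0`. [folklore] -/
def O : Set (Fin (n + 1) → ℂ) := {w | fChartDeriv F D.i w (Pi.single D.k 1) ≠ 0}

/-- `O` is open. [folklore] -/
theorem isOpen_O : IsOpen D.O :=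
  isOpen_ne_fun (continuous_fChartDeriv_single F D.i D.k) continuous_const

/-- The affine coordinates of the base point. [folklore] -/
def w₀ : Fin (n + 1) → ℂ := affineCoordComplex D.i D.p.1

/-- **The inverse-function-theorem chart of `Φ` at the base point**, restricted to `O`
(`HasStrictFDerivAt.toOpenPartialHomeomorph`). [cite: GriffithsHarrisPrinciples1978, Ch. 0 §2] -/
def Phi : OpenPartialHomeomorph (Fin (n + 1) → ℂ) (Fin (n + 1) → ℂ) :=
  ((D.hasStrictFDerivAt_phi D.w₀ D.hk).toOpenPartialHomeomorph D.phi).restrOpen D.O D.isOpen_O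

/-- `Phi` is the function `Φ`. [folklore] -/
@[simp] theorem Phi_apply (w : Fin (n + 1) → ℂ) : D.Phi w = D.phi w := rfl

/-- The base point lies in the source of `Phi`. [folklore] -/
theorem w₀_mem_source : D.w₀ ∈ D.Phi.source :=
  ⟨(D.hasStrictFDerivAt_phi D.w₀ D.hk).mem_toOpenPartialHomeomorph_source, D.hk⟩

/-- The source of `Phi` lies in `O`. [folklore] -/
theorem source_subset_O : D.Phi.source ⊆ D.O := fun _ hw => hw.2

/-- **The inverse of `Phi` is complex-smooth on its target** (the derivative of `Φ` is invertible
throughout the source, which lies in `O`). [cite: GriffithsHarrisPrinciples1978, Ch. 0 §2] -/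
theorem contDiffAt_Phi_symm {y : Fin (n + 1) → ℂ} (hy : y ∈ D.Phi.target) :
    ContDiffAt ℂ ω D.Phi.symm y :=
  D.Phi.contDiffAt_symm hy
    ((D.hasStrictFDerivAt_phi _ (D.source_subset_O (D.Phi.map_target hy))).hasFDerivAt)
    D.contDiff_phi.contDiffAt

/-- The target of the graph chart: `{v ∈ ℂⁿ | insertNth k 0 v ∈ Phi.target}`. [folklore] -/
def target : Set (Fin n → ℂ) := {v | (Fin.insertNth D.k (0 : ℂ) v : Fin (n + 1) → ℂ) ∈ D.Phi.target}

/-- The source of the graph chart: points of the `i`-th affine chart whose affine coordinates lie in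
`Phi.source`. [folklore] -/
def source : Set ↥(zeroSet F hF) :=
  {q | CoordNeZero D.i q.1 ∧ affineCoordComplex D.i q.1 ∈ D.Phi.source}

/-- The point of `ℂℙⁿ⁺¹` with graph-chart value `v`: `[homogenize i (Phi⁻¹ (insertNth k 0 v))]`.
[folklore] -/
def invVal (v : Fin n → ℂ) : ComplexProjectiveSpace (n + 1) :=
  ComplexProjectiveSpace.mk (homogenize D.i (D.Phi.symm (Fin.insertNth D.k 0 v)))

/-- `invVal v` lies in the `i`-th affine chart. [folklore] -/
theorem coordNeZero_invVal (v : Fin n → ℂ) : CoordNeZero D.i (D.invVal v) := by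
  simp [invVal, homogenize]

/-- The affine coordinates of `invVal v`. [folklore] -/
theorem affineCoordComplex_invVal (v : Fin n → ℂ) :
    affineCoordComplex D.i (D.invVal v) = D.Phi.symm (Fin.insertNth D.k 0 v) := by
  rw [invVal, affineCoordComplex_mk_homogenize]

/-- For `v` in the target, `Φ (Phi⁻¹ (insertNth k 0 v)) = insertNth k 0 v`. [folklore] -/
theorem phi_symm_insertNth {v : Fin n → ℂ} (hv : v ∈ D.target) :
    D.phi (D.Phi.symm (Fin.insertNth D.k 0 v)) = Fin.insertNth D.k 0 v := by
  rw [← Phi_apply]; exact D.Phi.right_inv hv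

/-- **For `v` in the target, `invVal v` lies on the hypersurface**: `f_i` is the `k`-th coordinate of
`Φ`, which is `0` there. [folklore] -/
theorem invVal_mem {v : Fin n → ℂ} (hv : v ∈ D.target) : D.invVal v ∈ zeroSet F hF := by
  have h2 : fChart F D.i (D.Phi.symm (Fin.insertNth D.k 0 v)) = 0 := by
    rw [← phi_apply_k, D.phi_symm_insertNth hv, Fin.insertNth_apply_same]
  rw [invVal, mk_mem_zeroSet_iff]
  exact h2

/-- Points of the source have graph-chart value in the target. [folklore] -/
theorem removeNth_mem_target {q : ↥(zeroSet F hF)} (hq : q ∈ D.source) :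
    Fin.removeNth D.k (affineCoordComplex D.i q.1) ∈ D.target := by
  change Fin.insertNth D.k 0 (Fin.removeNth D.k (affineCoordComplex D.i q.1)) ∈ D.Phi.target
  rw [← D.phi_eq_of_fChart_eq_zero (fChart_affineCoordComplex F hF q.2 hq.1), ← Phi_apply]
  exact D.Phi.map_source hq.2

/-- **The graph chart with values in `ℂⁿ`**: `[z] ↦ (affine coordinates of chart i, slot k removed)`,
inverse `v ↦ [homogenize i (Phi⁻¹ (insertNth k 0 v))]` (Griffiths–Harris, Ch. 0 §2: a complex
submanifold is locally a graph). [cite: GriffithsHarrisPrinciples1978, Ch. 0 §2] -/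
def graphChartC : OpenPartialHomeomorph ↥(zeroSet F hF) (Fin n → ℂ) :=
  haveI := Classical.propDecidable
  { toFun := fun q => Fin.removeNth D.k (affineCoordComplex D.i q.1)
    invFun := fun v => if hv : v ∈ D.target then ⟨D.invVal v, D.invVal_mem hv⟩ else D.p
    source := D.source
    target := D.target
    map_source' := fun q hq => D.removeNth_mem_target hq
    map_target' := fun v hv => by
      simp only [dif_pos hv]
      refine ⟨D.coordNeZero_invVal v, ?_⟩
      rw [affineCoordComplex_invVal]
      exact D.Phi.map_target hv
    left_inv' := fun q hq => by
      rw [dif_pos (D.removeNth_mem_target hq)]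
      apply Subtype.ext
      change ComplexProjectiveSpace.mk (homogenize D.i (D.Phi.symm (Fin.insertNth D.k 0
        (Fin.removeNth D.k (affineCoordComplex D.i q.1))))) = q.1
      rw [← D.phi_eq_of_fChart_eq_zero (fChart_affineCoordComplex F hF q.2 hq.1), ← Phi_apply,
        D.Phi.left_inv hq.2]
      exact mk_homogenize_affineCoordComplex hq.1
    right_inv' := fun v hv => by
      simp only [dif_pos hv]
      change Fin.removeNth D.k (affineCoordComplex D.i (D.invVal v)) = v
      rw [affineCoordComplex_invVal, ← D.removeNth_phi, D.phi_symm_insertNth hv, Fin.removeNth_insertNth]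
    open_source := by
      have h : IsOpen ({p : ComplexProjectiveSpace (n + 1) | CoordNeZero D.i p} ∩
          affineCoordComplex D.i ⁻¹' D.Phi.source) :=
        (continuousOn_affineCoordComplex D.i).isOpen_inter_preimage (isOpen_setOf_coordNeZero D.i)
          D.Phi.open_source
      exact h.preimage continuous_subtype_val
    open_target := D.Phi.open_target.preimage (by fun_prop)
    continuousOn_toFun := by
      have hrem : Continuous fun w : Fin (n + 1) → ℂ => Fin.removeNth D.k w :=
        continuous_pi fun j => continuous_apply _
      exact hrem.comp_continuousOn (((continuousOn_affineCoordComplex D.i).comp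
        continuous_subtype_val.continuousOn fun q hq => hq.1))
    continuousOn_invFun := by
      rw [Topology.IsInducing.subtypeVal.continuousOn_iff]
      have hval : ContinuousOn D.invVal D.target :=
        continuous_mk.comp_continuousOn ((continuous_homogenize _).comp_continuousOn
          (D.Phi.continuousOn_symm.comp (by fun_prop : Continuous fun v : Fin n → ℂ =>
            (Fin.insertNth D.k (0 : ℂ) v : Fin (n + 1) → ℂ)).continuousOn fun v hv => hv))
      refine hval.congr fun v hv => ?_
      simp only [comp_apply, dif_pos hv] }

/-- The graph chart is `q ↦ removeNth k (affine coordinates)`. [folklore] -/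
@[simp] theorem graphChartC_apply (q : ↥(zeroSet F hF)) :
    D.graphChartC q = Fin.removeNth D.k (affineCoordComplex D.i q.1) := rfl

/-- Its source. [folklore] -/
@[simp] theorem graphChartC_source : D.graphChartC.source = D.source := rfl

/-- Its target. [folklore] -/
@[simp] theorem graphChartC_target : D.graphChartC.target = D.target := rfl

/-- Its inverse on the target. [folklore] -/
theorem graphChartC_symm_apply {v : Fin n → ℂ} (hv : v ∈ D.target) :
    (D.graphChartC.symm v : ComplexProjectiveSpace (n + 1)) = D.invVal v := by
  classical
  have : D.graphChartC.symm v = if hv : v ∈ D.target then ⟨D.invVal v, D.invVal_mem hv⟩ else D.p := rfl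
  rw [this, dif_pos hv]

/-- The base point lies in the source of its graph chart. [folklore] -/
theorem p_mem_source : D.p ∈ D.source := ⟨D.hi, D.w₀_mem_source⟩

/-- **The graph chart with values in `ℝ²ⁿ`** (realified through `realCoordinates n`). [folklore] -/
def graphChart : OpenPartialHomeomorph ↥(zeroSet F hF) (EuclideanSpace ℝ (Fin (2 * n))) :=
  D.graphChartC.transHomeomorph (realCoordinates n).toHomeomorph

/-- Unfolding the realified graph chart. [folklore] -/
@[simp] theorem graphChart_apply (q : ↥(zeroSet F hF)) :
    D.graphChart q = realCoordinates n (D.graphChartC q) := by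
  simp [graphChart]

/-- Its inverse. [folklore] -/
@[simp] theorem graphChart_symm_apply (x : EuclideanSpace ℝ (Fin (2 * n))) :
    D.graphChart.symm x = D.graphChartC.symm ((realCoordinates n).symm x) := by
  simp [graphChart]

/-- Its source. [folklore] -/
@[simp] theorem graphChart_source : D.graphChart.source = D.source := by
  simp [graphChart]

/-- Its target. [folklore] -/
theorem graphChart_target : D.graphChart.target = (realCoordinates n).symm ⁻¹' D.target := by
  ext x
  simp [graphChart]

/-! #### The transition maps of graph charts are holomorphic -/

/-- For `y` in the source of the graph chart of `D'`, `Phi'⁻¹ (insertNth k' 0 (chart value of y))`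
recovers the affine coordinates of `y`. [folklore] -/
theorem symm_insertNth_graphChartC (D' : ChartData F hF) {y : ↥(zeroSet F hF)} (hy : y ∈ D'.source) :
    D'.Phi.symm (Fin.insertNth D'.k 0 (D'.graphChartC y)) = affineCoordComplex D'.i y.1 := by
  rw [graphChartC_apply, ← D'.phi_eq_of_fChart_eq_zero (fChart_affineCoordComplex F hF y.2 hy.1),
    ← Phi_apply, D'.Phi.left_inv hy.2]

/-- **The complex transition map between two graph charts is complex-smooth**: near the chart value
of `y ∈ source D ∩ source D'` it is
`v ↦ removeNth k (transitionComplex i' i (Phi'⁻¹ (insertNth k' 0 v)))`, a composite of holomorphic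
maps (Griffiths–Harris, Ch. 0 §2). [cite: GriffithsHarrisPrinciples1978, Ch. 0 §2] -/
theorem differentiableAt_transition (D D' : ChartData F hF) {y : ↥(zeroSet F hF)}
    (hy : y ∈ D.source) (hy' : y ∈ D'.source) :
    DifferentiableAt ℂ (fun v : Fin n → ℂ => D.graphChartC (D'.graphChartC.symm v)) (D'.graphChartC y) := by
  -- the explicit holomorphic model
  set T₀ : (Fin n → ℂ) → (Fin n → ℂ) := fun v =>
    Fin.removeNth D.k (transitionComplex D'.i D.i (D'.Phi.symm (Fin.insertNth D'.k 0 v))) with hT₀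
  have hv₀ : D'.graphChartC y ∈ D'.target := D'.removeNth_mem_target hy'
  have hev : (fun v : Fin n → ℂ => D.graphChartC (D'.graphChartC.symm v)) =ᶠ[𝓝 (D'.graphChartC y)] T₀ := by
    filter_upwards [D'.graphChartC.open_target.mem_nhds hv₀] with v hv
    rw [graphChartC_apply, D'.graphChartC_symm_apply hv, hT₀]
    rfl
  refine (Filter.EventuallyEq.differentiableAt_iff hev.symm).1 ?_
  -- smoothness of the pieces
  have h1 : ContDiffAt ℂ ω (fun v : Fin n → ℂ => (Fin.insertNth D'.k (0 : ℂ) v : Fin (n + 1) → ℂ))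
      (D'.graphChartC y) :=
    ((HypersurfaceComplement.insLin (N := n) D'.k).contDiff).contDiffAt
  have h2 : ContDiffAt ℂ ω D'.Phi.symm (Fin.insertNth D'.k 0 (D'.graphChartC y)) :=
    D'.contDiffAt_Phi_symm hv₀
  have hw₁ : D'.Phi.symm (Fin.insertNth D'.k 0 (D'.graphChartC y)) = affineCoordComplex D'.i y.1 :=
    D'.symm_insertNth_graphChartC hy'
  have h3 : ContDiffAt ℂ ω (transitionComplex D'.i D.i) (affineCoordComplex D'.i y.1) := by
    refine (contDiffOn_transitionComplex D'.i D.i).contDiffAt (IsOpen.mem_nhds ?_ ?_)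
    · exact isOpen_ne_fun ((contDiff_homogenize_apply D'.i D.i).continuous) continuous_const
    · change (homogenize D'.i (affineCoordComplex D'.i y.1) : Fin (n + 2) → ℂ) D.i ≠ 0
      have := hy.1
      rw [← mk_homogenize_affineCoordComplex hy'.1] at this
      exact this
  have h4 : ContDiff ℂ ω (fun w : Fin (n + 1) → ℂ => Fin.removeNth D.k w) :=
    contDiff_pi.2 fun j => contDiff_apply ℂ ℂ _
  have h21 : ContDiffAt ℂ ω (fun v : Fin n → ℂ => D'.Phi.symm (Fin.insertNth D'.k (0 : ℂ) v))
      (D'.graphChartC y) := h2.comp _ h1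
  have h321 : ContDiffAt ℂ ω
      (fun v : Fin n → ℂ => transitionComplex D'.i D.i (D'.Phi.symm (Fin.insertNth D'.k (0 : ℂ) v)))
      (D'.graphChartC y) := by
    refine ContDiffAt.comp (g := transitionComplex D'.i D.i)
      (f := fun v : Fin n → ℂ => D'.Phi.symm (Fin.insertNth D'.k (0 : ℂ) v)) _ ?_ h21
    rw [hw₁]; exact h3
  have hcomp : ContDiffAt ℂ ω T₀ (D'.graphChartC y) := h4.contDiffAt.comp _ h321
  exact hcomp.differentiableAt (by simp)

end ChartData

/-! ### The hypersurface as a charted space; orientation -/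

/-- **Graph chart data at a point** `q` of the hypersurface of a non-singular form: the preferred
affine chart of `q` and a slot `k` with `∂f/∂w_k ≠ 0` (`exists_fChartDeriv_single_ne_zero`). [folklore] -/
def chartDataAt (hNS : IsNonsingular F) (q : ↥(zeroSet F hF)) : ChartData F hF where
  p := q
  i := chartIndex q.1
  k := Classical.choose (exists_fChartDeriv_single_ne_zero hF hNS (chartIndex q.1)
    (affineCoordComplex (chartIndex q.1) q.1)
    (fChart_affineCoordComplex F hF q.2 (coordNeZero_chartIndex q.1)))
  hi := coordNeZero_chartIndex q.1
  hk := Classical.choose_spec (exists_fChartDeriv_single_ne_zero hF hNS (chartIndex q.1)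
    (affineCoordComplex (chartIndex q.1) q.1)
    (fChart_affineCoordComplex F hF q.2 (coordNeZero_chartIndex q.1)))

/-- The base point of `chartDataAt hNS q` is `q`. [folklore] -/
@[simp] theorem chartDataAt_p (hNS : IsNonsingular F) (q : ↥(zeroSet F hF)) :
    (chartDataAt (hF := hF) hNS q).p = q := rfl

variable (F hF)

/-- **The smooth projective hypersurface `Z_F ⊂ ℂℙⁿ⁺¹` as a type**: the subtype of `zeroSet F hF`,
as a synonym recording the non-singularity hypothesis used by its manifold structure. [folklore] -/
@[nolint unusedArguments]
abbrev Model (_hNS : IsNonsingular F) : Type := ↥(zeroSet F hF)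

variable (hNS : IsNonsingular F)

/-- The hypersurface is compact (a closed subset of the compact `ℂℙⁿ⁺¹`). [folklore] -/
instance : CompactSpace (Model F hF hNS) :=
  isCompact_iff_compactSpace.1 (isCompact_zeroSet F hF)

/-- **The charted-space structure of the hypersurface**: atlas all realified graph charts, preferred
chart the graph chart of `chartDataAt`. [cite: GriffithsHarrisPrinciples1978, Ch. 0 §2] -/
instance instChartedSpace : ChartedSpace (EuclideanSpace ℝ (Fin (2 * n))) (Model F hF hNS) where
  atlas := {e | ∃ D : ChartData F hF, e = D.graphChart}
  chartAt q := (chartDataAt (hF := hF) hNS q).graphChart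
  mem_chart_source q := by
    rw [ChartData.graphChart_source]
    exact (chartDataAt (hF := hF) hNS q).p_mem_source
  chart_mem_atlas q := ⟨_, rfl⟩

/-- Membership in the atlas. [folklore] -/
theorem mem_atlas_iff (e : OpenPartialHomeomorph (Model F hF hNS) (EuclideanSpace ℝ (Fin (2 * n)))) :
    e ∈ atlas (EuclideanSpace ℝ (Fin (2 * n))) (Model F hF hNS) ↔ ∃ D : ChartData F hF, e = D.graphChart :=
  Iff.rfl

/-- Graph charts are in the atlas. [folklore] -/
theorem graphChart_mem_atlas (D : ChartData F hF) :
    D.graphChart ∈ atlas (EuclideanSpace ℝ (Fin (2 * n))) (Model F hF hNS) := ⟨D, rfl⟩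

/-- **The atlas of graph charts is positive** (its transition maps are compositions of holomorphic
maps, `ChartData.differentiableAt_transition`, and `isPositiveAtlas_of_differentiable_complex`).
[cite: MilnorStasheff1974, §13 p. 151] -/
theorem isPositiveAtlas : IsPositiveAtlas (2 * n) (Model F hF hNS) := by
  refine isPositiveAtlas_of_differentiable_complex fun c hc c' hc' y hy => ?_
  obtain ⟨D, rfl⟩ := hc
  obtain ⟨D', rfl⟩ := hc'
  rw [ChartData.graphChart_source] at hy
  have h := ChartData.differentiableAt_transition D D' hy.1 hy.2
  have e1 : (fun v : Fin n → ℂ =>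
      (realCoordinates n).symm (D.graphChart (D'.graphChart.symm (realCoordinates n v)))) =
      fun v => D.graphChartC (D'.graphChartC.symm v) := by
    funext v
    rw [ChartData.graphChart_symm_apply, ChartData.graphChart_apply,
      ContinuousLinearEquiv.symm_apply_apply, ContinuousLinearEquiv.symm_apply_apply]
  have e2 : (realCoordinates n).symm (D'.graphChart y) = D'.graphChartC y := by
    rw [ChartData.graphChart_apply, ContinuousLinearEquiv.symm_apply_apply]
  have h' : DifferentiableAt ℂ (fun v : Fin n → ℂ => D.graphChartC (D'.graphChartC.symm v))
      ((realCoordinates n).symm (D'.graphChart y)) := by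
    rw [e2]; exact h
  rw [e1]
  exact h'

/-- **The orientation of the smooth projective hypersurface** `Z_F ⊂ ℂℙⁿ⁺¹` (as a homological
`ℤ`-orientation of the closed `2n`-manifold `Model F hF hNS`, from the positive atlas of graph
charts and an orientation `g` of the model `ℝ²ⁿ`; Milnor–Stasheff §13: "every complex manifold has
a preferred orientation"). [cite: MilnorStasheff1974, §13 p. 151] -/
def orientation (g : HomologicalOrientation ℤ (EuclideanSpace ℝ (Fin (2 * n))) (2 * n)) :
    HomologicalOrientation ℤ (Model F hF hNS) (2 * n) :=
  positiveAtlasOrientation (isPositiveAtlas F hF hNS) g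

/-- **The local classes of the orientation in a (restricted) atlas chart** (e.g. a graph chart,
`graphChart_mem_atlas`) are the push-forwards of the model classes (the form consumed by the
crossing formula `TransverseDiscDatum.functional_ofAbsolute_map_eq_sum`). [cite: MilnorStasheff1974, Appendix A] -/
theorem orientation_localClass_symm_restrOpen
    (g : HomologicalOrientation ℤ (EuclideanSpace ℝ (Fin (2 * n))) (2 * n))
    {c : OpenPartialHomeomorph (Model F hF hNS) (EuclideanSpace ℝ (Fin (2 * n)))}
    (hc : c ∈ atlas (EuclideanSpace ℝ (Fin (2 * n))) (Model F hF hNS))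
    {W : Set (Model F hF hNS)} (hW : IsOpen W) (r : ↥(c.restrOpen W hW).target) :
    relativeSingularHomology.map ℤ ℤ (subsetIncl (c.restrOpen W hW).source)
        (localHomology.mapsTo_subsetIncl_compl
          ((c.restrOpen W hW).toHomeomorphSourceTarget.symm r).2) (2 * n)
        (localHomology.xEquiv ℤ ℤ (c.restrOpen W hW).toHomeomorphSourceTarget.symm r (2 * n)
          ((localHomology.openSubsetIso ℤ ℤ (c.restrOpen W hW).open_target r.2 (2 * n)).inv
            (g.localClass (r : EuclideanSpace ℝ (Fin (2 * n)))))) =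
      (orientation F hF hNS g).localClass
        (((c.restrOpen W hW).toHomeomorphSourceTarget.symm r : ↥(c.restrOpen W hW).source) :
          Model F hF hNS) :=
  positiveAtlasOrientation_localClass_symm_restrOpen (isPositiveAtlas F hF hNS) g hc hW r

end Hypersurface

end Literature.AlgebraicGeometry.HodgeTheory

end
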